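import Summits.ResolutionOfSingularities.ResolutionOfSingularities.Theorems.EquisingularLiftEquisingularLiftNatClusterLiftDeltaRegular
import Mathlib
import HarnessLib

/-!
# [OURS · L1 W4.5(b)] T-CLUSTER-LIFT part 8 — THE WITNESS `M̄` of part 7: a degree-`d` form THROUGH the fat cluster AVOIDING finitely
# many conditions (subspace avoidance inside the cluster system over an infinite field), and its discharge at closed points off the
# cluster when `Σ m_t ≤ d` (crux `EquisingularLiftNat` = stmt-ResolutionOfSingularities-20038, line `sections`; rung v7′ TC⁺⁺)

NOT a statement of any manuscript. Helper file of the chain res-L1-w45b (cell `res-hironaka`, LADDER-RESOLUTION rung L, slot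
W4.5(b)); OURS; AI-written, weaker than expert review; `--supports stmt-ResolutionOfSingularities-20038 --as helper` by
res-L1-w45b-stub-3 (object T-CLUSTER-LIFT part 8 = offer (A)(ii)). No `sorry`; standard axioms.

WHAT. Part 7 (`exists_isHomogeneous_clusterLift_deltaRegular_off`) takes a WITNESS `M̄ ∈ k[T_σ]_d` of order `≥ m_t` at every
cluster point with `M̄(T_j := 1) ∉ 𝔮` for the finitely many bad primes `𝔮` off the excluded sets. Here:

* **`exists_clusterForm_forall_dehomogenize_notMem`** — SUBSPACE AVOIDANCE INSIDE THE CLUSTER SYSTEM: over an INFINITE field, if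
  for each of finitely many conditions `(j_s, 𝔮_s)` (`𝔮_s` any ideal of the chart ring `k[T_{≠ j_s}]`) SOME degree-`d` form through
  the fat cluster has `(·)(T_{j_s} := 1) ∉ 𝔮_s`, then ONE degree-`d` form through the fat cluster avoids them all (Mathlib
  `Submodule.exists_forall_notMem_of_forall_ne_top` on the cluster system; res-type-032's
  `exists_isHomogeneous_forall_dehomogenize_notMem`, p516044, is the clusterless case);
* `one_notMem_span_X_sub_C` — the point ideal `𝔪_b = (X_l − b_l : l)` is proper;
* **`exists_clusterForm_dehomogenize_notMem_point`** — DISCHARGE AT A CLOSED POINT OFF THE CLUSTER: pairwise distinct points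
  `â_t` of `ℙ` with `Σ_t m_t ≤ d` and a further point `b̂` (chart `j`) distinct from all of them ⇒ a degree-`d` form through the fat
  cluster NOT vanishing at `b` (`(·)(T_j := 1) ∉ 𝔪_b`) — part 5 applied to the cluster `{m_t·a_t} + 1·b` (`Σ + 1 ≤ d + 1`),
  prescribing class `0` at the `a_t` and class `1` at `b`.
So for a reduced trace whose non-sectioned singular points are closed `k`-points `b` (each bad prime being `𝔪_b`), part 7's witness
exists as soon as `Σ_t m_t ≤ d`. Finally
* **`exists_isHomogeneous_clusterLift_deltaRegular_off_linear`** (namespace `…Sections`) — part 7's Δ-regular cluster-centred cone with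
  the standard dehomogenisations replaced by an ARBITRARY finite family of `O`-linear chart maps `L_κ` with reductions `l_κ`, so that the
  STRICT-TRANSFORM CHARTS over the sectioned points (`O`-linear in `Φ` on the cluster system) share the genericity constant `c`.

References: parts 1–7; Mathlib `Submodule.exists_forall_notMem_of_forall_ne_top`. res-L1-w45b-lead-2 LEAD-MEMO-5/6 (v7′ TC⁺⁺);
res-L1-w45b-stub-1 HSUB′ skeleton (OURS planning texts, index only).
-/

set_option linter.dupNamespace false -- mandated namespace `Summit.<Summit>.<Problem>` of this single-conjunct summit

noncomputable section

open MvPolynomial Literature.AlgebraicGeometry.Resolution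

namespace Summit.ResolutionOfSingularities.ResolutionOfSingularities.Theorems.EquisingularLiftNat.ClusterLift

/-! ## Subspace avoidance inside the cluster system -/

section Avoid

variable {k : Type*} [Field k] [Infinite k] {σ : Type*} [DecidableEq σ] {ι : Type*} (i : ι → σ)

/-- **A form through the fat cluster avoiding finitely many conditions.** `k` an infinite field; cluster data (charts `i_t`, affine
coordinates `a_t`, orders `m_t`); finitely many conditions `(j_s, 𝔮_s)` with `𝔮_s` an ideal of `k[T_{≠ j_s}]`. If for every `s` some
degree-`d` form of order `≥ m_t` at every `a_t` has `(·)(T_{j_s} := 1) ∉ 𝔮_s`, then one such form avoids ALL the `𝔮_s`: inside the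
cluster system the forms failing condition `s` form a proper subspace, and a vector space over an infinite field is not a finite
union of proper subspaces. [folklore] [OURS · L1 W4.5b] -/
theorem exists_clusterForm_forall_dehomogenize_notMem (a : (t : ι) → {j : σ // j ≠ i t} → k) (m : ι → ℕ) (d : ℕ)
    {S : Type*} [Finite S] (j : S → σ) (𝔮 : (s : S) → Ideal (MvPolynomial {l : σ // l ≠ j s} k))
    (hwit : ∀ s, ∃ w : MvPolynomial σ k, w.IsHomogeneous d ∧
      (∀ t, dehomogenize (i t) w ∈
        (Ideal.span (Set.range fun l => (X l : MvPolynomial {l : σ // l ≠ i t} k) - C (a t l))) ^ m t) ∧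
      dehomogenize (j s) w ∉ 𝔮 s) :
    ∃ M : MvPolynomial σ k, M.IsHomogeneous d ∧
      (∀ t, dehomogenize (i t) M ∈
        (Ideal.span (Set.range fun l => (X l : MvPolynomial {l : σ // l ≠ i t} k) - C (a t l))) ^ m t) ∧
      ∀ s, dehomogenize (j s) M ∉ 𝔮 s := by
  -- the cluster system as a `k`-subspace of `k[T_σ]`
  let V : Submodule k (MvPolynomial σ k) := homogeneousSubmodule σ k d ⊓
    ⨅ t, Submodule.comap (dehomogenize (i t)).toLinearMap
      (((Ideal.span (Set.range fun l => (X l : MvPolynomial {l : σ // l ≠ i t} k) - C (a t l))) ^ m t).restrictScalars k)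
  have hV : ∀ w : MvPolynomial σ k, w ∈ V ↔ w.IsHomogeneous d ∧ ∀ t, dehomogenize (i t) w ∈
      (Ideal.span (Set.range fun l => (X l : MvPolynomial {l : σ // l ≠ i t} k) - C (a t l))) ^ m t := by
    intro w
    simp only [V, Submodule.mem_inf, mem_homogeneousSubmodule, Submodule.mem_iInf, Submodule.mem_comap,
      AlgHom.toLinearMap_apply, Submodule.restrictScalars_mem]
  let p : S → Submodule k V := fun s =>
    ((𝔮 s).restrictScalars k).comap ((dehomogenize (j s)).toLinearMap ∘ₗ V.subtype)
  have hp : ∀ s, p s ≠ ⊤ := by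
    intro s hs
    obtain ⟨w, hw, hwZ, hw𝔮⟩ := hwit s
    have hmem : (⟨w, (hV w).mpr ⟨hw, hwZ⟩⟩ : V) ∈ p s := by rw [hs]; exact Submodule.mem_top
    exact hw𝔮 hmem
  obtain ⟨x, hx⟩ := Submodule.exists_forall_notMem_of_forall_ne_top p hp
  obtain ⟨hx1, hx2⟩ := (hV x.1).mp x.2
  exact ⟨x.1, hx1, hx2, fun s hs => hx s hs⟩

end Avoid

/-! ## Discharge at a closed point off the cluster -/

section Point

variable {k : Type*} [Field k] {σ : Type*} [Finite σ] [DecidableEq σ]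

omit [Finite σ] in
/-- The point ideal `𝔪_b = (X_l − b_l : l)` is proper: `1 ∉ 𝔪_b`. [folklore] -/
theorem one_notMem_span_X_sub_C {τ : Type*} (b : τ → k) :
    (1 : MvPolynomial τ k) ∉ Ideal.span (Set.range fun l : τ => (X l : MvPolynomial τ k) - C (b l)) := by
  intro h
  have h1 := (mem_pow_span_X_sub_C_iff b 1 (1 : MvPolynomial τ k)).mp (by rwa [pow_one]) 0
    (by rw [map_zero]; exact zero_lt_one)
  rw [map_one, coeff_zero_one] at h1
  exact one_ne_zero h1

variable {ι : Type*} [Fintype ι] [DecidableEq ι] (i : ι → σ)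

/-- **A form through the fat cluster not vanishing at a further point, for `Σ m_t ≤ d`.** Pairwise distinct points `â_t` of `ℙ`
(charts `i_t`, affine coordinates `a_t`), orders `m_t` with `Σ_t m_t ≤ d`, and a point `b̂` (chart `j`, coordinates `b`) distinct
from every `â_t` (both non-proportionalities). THEN there is a degree-`d` form `w` of order `≥ m_t` at every `a_t` with
`w(T_j := 1) ∉ 𝔪_b` — part 5 on the cluster `{m_t · a_t} + 1 · b`, classes `0` at the `a_t` and `1` at `b`. (The witness of part 7 at
a non-sectioned singular point `b` of the trace.) [OURS · L1 W4.5b] -/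
theorem exists_clusterForm_dehomogenize_notMem_point (a : (t : ι) → {l : σ // l ≠ i t} → k)
    (hdist : ∀ t t', t ≠ t' → ¬ ∃ c : k, (fun l : σ => if h : l = i t' then (1 : k) else a t' ⟨l, h⟩) =
      c • (fun l : σ => if h : l = i t then (1 : k) else a t ⟨l, h⟩))
    (m : ι → ℕ) {d : ℕ} (hd : ∑ t, m t ≤ d) (j : σ) (b : {l : σ // l ≠ j} → k)
    (hb₁ : ∀ t, ¬ ∃ c : k, (fun l : σ => if h : l = j then (1 : k) else b ⟨l, h⟩) =
      c • (fun l : σ => if h : l = i t then (1 : k) else a t ⟨l, h⟩))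
    (hb₂ : ∀ t, ¬ ∃ c : k, (fun l : σ => if h : l = i t then (1 : k) else a t ⟨l, h⟩) =
      c • (fun l : σ => if h : l = j then (1 : k) else b ⟨l, h⟩)) :
    ∃ w : MvPolynomial σ k, w.IsHomogeneous d ∧
      (∀ t, dehomogenize (i t) w ∈
        (Ideal.span (Set.range fun l => (X l : MvPolynomial {l : σ // l ≠ i t} k) - C (a t l))) ^ m t) ∧
      dehomogenize j w ∉ Ideal.span (Set.range fun l => (X l : MvPolynomial {l : σ // l ≠ j} k) - C (b l)) := by
  -- the extended cluster, indexed by `Option ι` (`none ↦ b` with order `1`)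
  let i' : Option ι → σ := fun o => o.elim j i
  let a' : (o : Option ι) → {l : σ // l ≠ i' o} → k := fun o => match o with
    | none => b
    | some t => a t
  let m' : Option ι → ℕ := fun o => o.elim 1 m
  have hd' : ∑ o, m' o ≤ d + 1 := by
    rw [Fintype.sum_option]
    change 1 + ∑ t, m t ≤ d + 1
    omega
  have hdist' : ∀ o o' : Option ι, o ≠ o' → ¬ ∃ c : k,
      (fun l : σ => if h : l = i' o' then (1 : k) else a' o' ⟨l, h⟩) =
        c • (fun l : σ => if h : l = i' o then (1 : k) else a' o ⟨l, h⟩) := by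
    rintro (_ | t) (_ | t') hne
    · exact absurd rfl hne
    · exact hb₂ t'
    · exact hb₁ t
    · exact hdist t t' fun h => hne (congrArg some h)
  obtain ⟨w, hw, hwc⟩ := exists_isHomogeneous_forall_mk_dehomogenize_eq_charts i' a' hdist' m' hd'
    (fun o => match o with
      | none => 1
      | some _ => 0)
  refine ⟨w, hw, fun t => ?_, ?_⟩
  · exact Ideal.Quotient.eq_zero_iff_mem.mp (hwc (some t))
  · intro hmem
    have h1 : Ideal.Quotient.mk ((Ideal.span (Set.range fun l => (X l : MvPolynomial {l : σ // l ≠ j} k) - C (b l))) ^ 1)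
        (dehomogenize j w) = 1 := hwc none
    rw [pow_one] at h1
    rw [Ideal.Quotient.eq_zero_iff_mem.mpr hmem] at h1
    exact one_notMem_span_X_sub_C b ((Ideal.Quotient.eq_zero_iff_mem).mp (by rw [map_one]; exact h1.symm))

end Point

end Summit.ResolutionOfSingularities.ResolutionOfSingularities.Theorems.EquisingularLiftNat.ClusterLift

/-! ## Part 7's cone with ARBITRARY linear chart maps (strict-transform charts included) -/

namespace Summit.ResolutionOfSingularities.ResolutionOfSingularities.Cruxes.EquisingularLiftNat.Sections

open IsLocalRing Summit.ResolutionOfSingularities.ResolutionOfSingularities.Theorems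
open Summit.ResolutionOfSingularities.ResolutionOfSingularities.Theorems.EquisingularLiftNat.ClusterLift

universe u

set_option linter.overlappingInstances false in -- [IsDomain O] and [IsDiscreteValuationRing O] as in …NatDeltaConeLift
/-- **THE Δ-REGULAR CLUSTER-CENTRED CONE, general chart maps.** As part 7's `exists_isHomogeneous_clusterLift_deltaRegular_off`, but
the Δ-regularity is demanded for an ARBITRARY finite family of `O`-LINEAR «chart maps» `L_κ : O[T_σ] → O[x_{τ_κ}]` with reductions
`l_κ` (`map π ∘ L_κ = l_κ ∘ map π`) instead of the standard dehomogenisations — so that the STRICT-TRANSFORM CHARTS over the sectioned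
points (package (vi) of res-L1-w45b-stub-1's HSUB′ architecture: `Φ(T_i := 1)(a + (u, uv)) = u^m · Φu` is `O`-linear in `Φ` on the
cluster system) can be fed to the SAME genericity constant `c`: given the bad-prime finiteness of each `l_κ g`, excluded sets `E_κ`,
and a witness `M̄` through the cluster with `l_κ M̄ ∉ 𝔮` for the bad `𝔮 ∉ E_κ`, there is `Φ = G + c·ϖ·M ∈ O[T_σ]_d`, `π Φ = g`,
centred at every section, with `O[x_{τ_κ}]/(L_κ Φ)` regular at every prime `Q ∋ ϖ` not over `E_κ`, for every `κ`.
[cite: Matsumura1987, Thm. 14.2] [OURS · L1 W4.5b] -/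
theorem exists_isHomogeneous_clusterLift_deltaRegular_off_linear {O : Type u} [CommRing O] [IsDomain O]
    [IsDiscreteValuationRing O] {ϖ : O} {k : Type u} [Field k] [Infinite k] {σ : Type*} [Finite σ] [DecidableEq σ]
    {ι : Type*} [Finite ι] {K : Type*} [Finite K] {τ : K → Type u} [∀ κ, Finite (τ κ)]
    (hϖ : Irreducible ϖ) (π : O →+* k) (hπ : Function.Surjective π) (hker : RingHom.ker π = Ideal.span {ϖ}) {d : ℕ}
    (i : ι → σ) (a : (t : ι) → {j : σ // j ≠ i t} → O) (m : ι → ℕ)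
    (hind : ∀ v : (t : ι) → ({j : σ // j ≠ i t} →₀ ℕ) → k, ∃ g' : MvPolynomial σ k, g'.IsHomogeneous d ∧
      ∀ t α, α.degree < m t →
        coeff α (aeval (fun j => (X j : MvPolynomial {j : σ // j ≠ i t} k) + C (π (a t j))) (dehomogenize (i t) g'))
          = v t α)
    (g : MvPolynomial σ k) (hg : g.IsHomogeneous d)
    (hgZ : ∀ t, dehomogenize (i t) g ∈
      (Ideal.span (Set.range fun j => (X j : MvPolynomial {j : σ // j ≠ i t} k) - C (π (a t j)))) ^ m t)
    (L : (κ : K) → MvPolynomial σ O →ₗ[O] MvPolynomial (τ κ) O)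
    (l : (κ : K) → MvPolynomial σ k →ₗ[k] MvPolynomial (τ κ) k)
    (hLl : ∀ κ F, MvPolynomial.map π (L κ F) = l κ (MvPolynomial.map π F))
    (E : (κ : K) → Set (PrimeSpectrum (MvPolynomial (τ κ) k)))
    (hfin : ∀ κ, {𝔮 : PrimeSpectrum (MvPolynomial (τ κ) k) | l κ g ∈ 𝔮.asIdeal ∧
      algebraMap (MvPolynomial (τ κ) k) (Localization.AtPrime 𝔮.asIdeal) (l κ g) ∈
        maximalIdeal (Localization.AtPrime 𝔮.asIdeal) ^ 2}.Finite)
    (Mbar : MvPolynomial σ k) (hMbar : Mbar.IsHomogeneous d)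
    (hMZ : ∀ t, dehomogenize (i t) Mbar ∈
      (Ideal.span (Set.range fun j => (X j : MvPolynomial {j : σ // j ≠ i t} k) - C (π (a t j)))) ^ m t)
    (hMavoid : ∀ (κ : K) (𝔮 : PrimeSpectrum (MvPolynomial (τ κ) k)), 𝔮 ∉ E κ → l κ g ∈ 𝔮.asIdeal →
      algebraMap (MvPolynomial (τ κ) k) (Localization.AtPrime 𝔮.asIdeal) (l κ g) ∈
        maximalIdeal (Localization.AtPrime 𝔮.asIdeal) ^ 2 →
      l κ Mbar ∉ 𝔮.asIdeal) :
    ∃ Φ : MvPolynomial σ O, Φ.IsHomogeneous d ∧ MvPolynomial.map π Φ = g ∧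
      (∀ t, dehomogenize (i t) Φ ∈
        (Ideal.span (Set.range fun j => (X j : MvPolynomial {j : σ // j ≠ i t} O) - C (a t j))) ^ m t) ∧
      ∀ (κ : K) (Q : Ideal (MvPolynomial (τ κ) O ⧸ Ideal.span {L κ Φ})) [Q.IsPrime],
        Ideal.Quotient.mk (Ideal.span {L κ Φ}) (C ϖ : MvPolynomial (τ κ) O) ∈ Q →
        (∀ 𝔮 ∈ E κ, 𝔮.asIdeal.comap (MvPolynomial.map (σ := τ κ) π) ≠
          Q.comap (Ideal.Quotient.mk (Ideal.span {L κ Φ}))) →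
        IsRegularLocalRing (Localization.AtPrime Q) := by
  classical
  haveI : Fintype K := Fintype.ofFinite K
  have hπϖ : π ϖ = 0 := by
    rw [← RingHom.mem_ker, hker]
    exact Ideal.mem_span_singleton_self ϖ
  have hkerj : RingHom.ker π ≤ (⊥ : Ideal O).jacobson := by
    rw [hker, ← hϖ.maximalIdeal_eq]
    exact IsLocalRing.maximalIdeal_le_jacobson _
  obtain ⟨G, hG, hGg, hGZ⟩ := exists_isHomogeneous_lift_forall_dehomogenize_mem_pow π hπ hkerj i a m hind g hg hgZ
  obtain ⟨M, hM, hMM, hMZ'⟩ := exists_isHomogeneous_lift_forall_dehomogenize_mem_pow π hπ hkerj i a m hind Mbar hMbar hMZ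
  have hGκ : ∀ κ, MvPolynomial.map π (L κ G) = l κ g := fun κ => by rw [hLl, hGg]
  have hMκ : ∀ κ, MvPolynomial.map π (L κ M) = l κ Mbar := fun κ => by rw [hLl, hMM]
  have hchart := fun κ : K =>
    deltaRegularGeneric_mul_model_off hϖ π hπ hker (L κ G) (L κ M) (E κ)
      (by rw [hGκ]; exact hfin κ)
      (by
        intro 𝔮 h𝔮E h1 h2
        rw [hMκ]
        rw [hGκ] at h1 h2
        exact hMavoid κ 𝔮 h𝔮E h1 h2)
  choose S hS using hchart
  obtain ⟨y, hy⟩ := Infinite.exists_notMem_finset (Finset.univ.biUnion S)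
  obtain ⟨c, rfl⟩ := hπ y
  have hcS : ∀ κ, π c ∉ S κ := fun κ hκ => hy (Finset.mem_biUnion.mpr ⟨κ, Finset.mem_univ _, hκ⟩)
  refine ⟨G + C (c * ϖ) * M, hG.add (hM.C_mul _), ?_, fun t => ?_, fun κ Q _ hQ hQE => ?_⟩
  · rw [map_add, map_mul, map_C, map_mul π, hπϖ, mul_zero, C_0, zero_mul, add_zero, hGg]
  · rw [map_add, map_mul, MvPolynomial.algHom_C, MvPolynomial.algebraMap_eq]
    exact Ideal.add_mem _ (hGZ t) (Ideal.mul_mem_left _ _ (hMZ' t))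
  · have hL : L κ (G + C (c * ϖ) * M) = L κ G + C (c * ϖ) * L κ M := by
      rw [map_add, ← smul_eq_C_mul, LinearMap.map_smul, smul_eq_C_mul]
    have key := hS κ c (hcS κ)
    revert Q
    rw [hL]
    intro Q _ hQ hQE
    exact key Q hQ hQE

end Summit.ResolutionOfSingularities.ResolutionOfSingularities.Cruxes.EquisingularLiftNat.Sections

end
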